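import Literature.Analysis.FluidPDE.PassiveVectorTensorRepresentative
import Literature.Analysis.FluidPDE.PassiveVectorTensorLionsExistence
import Mathlib.Analysis.InnerProductSpace.Projection.Basic
import Mathlib.MeasureTheory.Function.L2Space
import HarnessLib

/-!
# Weak passive solenoidal vectors with a constant viscosity tensor: the two-parameter SOLUTION PROPAGATOR on `L²`

Analysis/FluidPDE file (definitions `divFreeL2`, `IsPropagator` + proofs; no named facts).  For the linear problem
`∂ₜw + (b·∇)w + ∇π = ∇·(𝔸∇w)`, `∇·w = 0` on `T^d × [0,T)` (`Torus.IsWeakTensorPassiveVectorOn 0 …`, Frisch (9.57); elliptic constant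
tensor `NearIso 𝔸 lo hi`, `lo > 0`; bounded, a.e. divergence-free carrier) the weak solutions from `L²` divergence-free data form a
two-parameter family of linear contractions `U(s,t)` of `L²(T^d; ℝ^d)` (extended by `0` on the orthogonal complement of the divergence-free
classes), with the cocycle property and strong measurability in the data — the EVOLUTION OPERATOR of Pazy, Ch. 5 §5.1 / the semigroup
property of DiPerna–Lions 1989 §II.1, for the Lions–Magenes weak solutions (Chap. 3 Thm. 1.1).  Cell `ad-ideate`, crux K1L_D, tenure D24-7
«S0′»: the interface `IsPropagator` is EXACTLY the one typed by planner ad-ideate-p4 g11 in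
`Summits/…/Cruxes/LagrangianRenormalisationStep/OneLevelSplitSketch.lean` §0 (field names are consumed by name).

* `Torus.divFreeL2 d` — the submodule of `Lp (EuclideanSpace ℝ d) 2 volume` of weakly divergence-free classes; it is closed
  (`isClosed_divFreeL2`), hence complete and admits the orthogonal projection `(divFreeL2 d).starProjection`;
* `Torus.IsPropagator T b 𝔸 U` — the seven-field spec (contraction, cocycle, identity on divergence-free data, divergence-free range,
  vanishing on the orthogonal complement, continuity in `t`, representation of every weak solution);
* `Torus.exists_isPropagator` — EXISTENCE of such a `U` for `0 < T`, `NearIso 𝔸 lo hi`, `0 < lo`, `stLift b ∈ L^∞((0,T) × T^d)`,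
  `b(t)` weakly divergence free for a.e. `t` (Lions existence `exists_isWeakTensorPassiveVectorOn`, uniqueness `ae_eq_of_memLp_top`,
  superposition `add`/`const_smul`, the weakly continuous representative and its traces `PassiveVectorTensorRepresentative`, the energy
  inequality `ae_integral_norm_sq_le`).

## References

* A. Pazy, *Semigroups of Linear Operators and Applications to PDE*, Springer 1983, Ch. 5 §5.1 (evolution systems). [`Pazy1983`]
* J.-L. Lions, E. Magenes, *Non-Homogeneous Boundary Value Problems* I (1972), Chap. 3 Thm. 1.1. [`LionsMagenes1972`]
* R. J. DiPerna, P.-L. Lions, Invent. Math. 98 (1989), §II.1 (12)–(14). [`DiPernaLions1989`]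
* R. Temam, *Navier–Stokes Equations* (1984), Ch. III §1 Lemma 1.4. [`Temam1984`]
-/

noncomputable section

open MeasureTheory Set Filter Function TopologicalSpace UnitAddTorus
open scoped ENNReal NNReal InnerProductSpace Topology

namespace Literature.Analysis.FluidPDE

namespace Torus

variable (d : Type*) [Fintype d] [DecidableEq d]

/-! ## The closed subspace of weakly divergence-free `L²` classes -/

omit [DecidableEq d] in
/-- The pairing of an `L²` class with a fixed `L²` field is the `L²` inner product with its class. [folklore] -/
private theorem integral_inner_coeFn_eq_inner {φ : UnitAddTorus d → EuclideanSpace ℝ d} (hφ : MemLp φ 2 volume)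
    (y : Lp (EuclideanSpace ℝ d) 2 (volume : Measure (UnitAddTorus d))) :
    ∫ x, ⟪(y : UnitAddTorus d → EuclideanSpace ℝ d) x, φ x⟫_ℝ = ⟪y, hφ.toLp φ⟫_ℝ := by
  rw [MeasureTheory.L2.inner_def]
  refine integral_congr_ae ?_
  filter_upwards [hφ.coeFn_toLp] with x hx
  rw [hx]

/-- **The weakly divergence-free `L²` classes** form a submodule of `L²(T^d; ℝ^d)` (pairings with smooth gradients are linear and
insensitive to the representative). [cite: Temam1984, Ch. I §1.4 Thm. 1.4] -/
def divFreeL2 : Submodule ℝ (Lp (EuclideanSpace ℝ d) 2 (volume : Measure (UnitAddTorus d))) where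
  carrier := {y | FunctionSpaces.Torus.IsWeaklyDivFree (y : UnitAddTorus d → EuclideanSpace ℝ d)}
  add_mem' := by
    intro y z hy hz θ hθ
    have hg : MemLp (FunctionSpaces.Torus.gradient θ) 2 volume := (FunctionSpaces.Torus.IsSmooth.gradient hθ).memLp 2
    have e : ∫ x, ⟪((y + z : Lp (EuclideanSpace ℝ d) 2 volume) : UnitAddTorus d → EuclideanSpace ℝ d) x,
        FunctionSpaces.Torus.gradient θ x⟫_ℝ = ⟪y + z, hg.toLp _⟫_ℝ := integral_inner_coeFn_eq_inner d hg _
    rw [e, inner_add_left, ← integral_inner_coeFn_eq_inner d hg, ← integral_inner_coeFn_eq_inner d hg, hy θ hθ, hz θ hθ, add_zero]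
  zero_mem' := by
    intro θ hθ
    have hg : MemLp (FunctionSpaces.Torus.gradient θ) 2 volume := (FunctionSpaces.Torus.IsSmooth.gradient hθ).memLp 2
    rw [integral_inner_coeFn_eq_inner d hg, inner_zero_left]
  smul_mem' := by
    intro c y hy θ hθ
    have hg : MemLp (FunctionSpaces.Torus.gradient θ) 2 volume := (FunctionSpaces.Torus.IsSmooth.gradient hθ).memLp 2
    have e : ∫ x, ⟪((c • y : Lp (EuclideanSpace ℝ d) 2 volume) : UnitAddTorus d → EuclideanSpace ℝ d) x,
        FunctionSpaces.Torus.gradient θ x⟫_ℝ = ⟪c • y, hg.toLp _⟫_ℝ := integral_inner_coeFn_eq_inner d hg _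
    rw [e, real_inner_smul_left, ← integral_inner_coeFn_eq_inner d hg, hy θ hθ, mul_zero]

variable {d}

omit [DecidableEq d] in
/-- Membership in `divFreeL2`, unfolded: the class pairs to zero with every smooth gradient. [cite: Temam1984, Ch. I §1.4 Thm. 1.4] -/
theorem mem_divFreeL2_iff (y : Lp (EuclideanSpace ℝ d) 2 (volume : Measure (UnitAddTorus d))) :
    y ∈ divFreeL2 d ↔ FunctionSpaces.Torus.IsWeaklyDivFree (y : UnitAddTorus d → EuclideanSpace ℝ d) := Iff.rfl

omit [DecidableEq d] in
/-- **`divFreeL2` is closed** (an intersection of kernels of the continuous functionals `y ↦ ⟪y, ∇θ⟫`).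
[cite: Temam1984, Ch. I §1.4 Thm. 1.4] -/
theorem isClosed_divFreeL2 : IsClosed (divFreeL2 d : Set (Lp (EuclideanSpace ℝ d) 2 (volume : Measure (UnitAddTorus d)))) := by
  have e : (divFreeL2 d : Set (Lp (EuclideanSpace ℝ d) 2 (volume : Measure (UnitAddTorus d)))) =
      ⋂ θ : {θ : UnitAddTorus d → ℝ // FunctionSpaces.Torus.IsSmooth θ},
        {y | ⟪y, ((FunctionSpaces.Torus.IsSmooth.gradient θ.2).memLp 2).toLp (FunctionSpaces.Torus.gradient θ.1)⟫_ℝ = 0} := by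
    ext y
    simp only [SetLike.mem_coe, mem_divFreeL2_iff, Set.mem_iInter, Set.mem_setOf_eq]
    constructor
    · intro hy θ
      rw [← integral_inner_coeFn_eq_inner d]
      exact hy θ.1 θ.2
    · intro hy θ hθ
      rw [integral_inner_coeFn_eq_inner d ((FunctionSpaces.Torus.IsSmooth.gradient hθ).memLp 2)]
      exact hy ⟨θ, hθ⟩
  rw [e]
  exact isClosed_iInter fun θ => isClosed_eq (continuous_id.inner continuous_const) continuous_const

omit [DecidableEq d] in
/-- `divFreeL2` is complete (a closed subspace of the Hilbert space `L²`), hence admits the orthogonal projection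
`(divFreeL2 d).starProjection`. [cite: Temam1984, Ch. I §1.4 Thm. 1.4] -/
theorem completeSpace_divFreeL2 : CompleteSpace (divFreeL2 d) := (isClosed_divFreeL2 (d := d)).completeSpace_coe

/-- The complete-space instance on `divFreeL2` (so that `Submodule.HasOrthogonalProjection.ofCompleteSpace` fires). [folklore] -/
instance : CompleteSpace (divFreeL2 d) := completeSpace_divFreeL2


/-! ## Tools for the construction: shifted carriers, datum congruence -/

section Tools

variable {A T : ℝ} {𝔸 : Visc4 d} {b w : ℝ → UnitAddTorus d → EuclideanSpace ℝ d} {w₀ w₀' : UnitAddTorus d → EuclideanSpace ℝ d}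

omit [DecidableEq d] in
/-- The essential bound of the carrier passes to the time-shifted carrier `τ ↦ b (s + τ)` on `(0, T − s) × T^d` (translation is
measure preserving). [folklore] -/
private theorem memLp_top_stLift_comp_add_left
    (hb : MemLp (FunctionSpaces.Torus.stLift b) ∞ (volume.restrict (Ioo 0 T ×ˢ univ))) {s : ℝ} (hs : 0 ≤ s) :
    MemLp (FunctionSpaces.Torus.stLift (fun τ => b (s + τ))) ∞ (volume.restrict (Ioo 0 (T - s) ×ˢ univ)) := by
  set θ : ℝ × EuclideanSpace ℝ d → ℝ × EuclideanSpace ℝ d := fun p => (s + p.1, p.2) with hθ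
  have hθmp : MeasurePreserving θ (volume : Measure (ℝ × EuclideanSpace ℝ d)) volume := by
    have h := (measurePreserving_add_left (volume : Measure ℝ) s).prod
      (MeasurePreserving.id (volume : Measure (EuclideanSpace ℝ d)))
    have e : Prod.map (fun t : ℝ => s + t) id = θ := by
      funext p; rfl
    rw [e] at h
    exact h
  have hpre : θ ⁻¹' (Ioo s T ×ˢ univ) = Ioo 0 (T - s) ×ˢ univ := by
    ext p
    simp only [hθ, mem_preimage, mem_prod, mem_univ, and_true, mem_Ioo]
    constructor <;> rintro ⟨h1, h2⟩ <;> constructor <;> linarith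
  have hθr : MeasurePreserving θ (volume.restrict (Ioo 0 (T - s) ×ˢ univ)) (volume.restrict (Ioo s T ×ˢ univ)) := by
    have h := hθmp.restrict_preimage (measurableSet_Ioo.prod MeasurableSet.univ) (s := Ioo s T ×ˢ univ)
    rwa [hpre] at h
  have hb₀ : MemLp (FunctionSpaces.Torus.stLift b) ∞ (volume.restrict (Ioo s T ×ˢ univ)) :=
    hb.mono_measure (Measure.restrict_mono (prod_mono (Ioo_subset_Ioo hs le_rfl) le_rfl) le_rfl)
  have hcomp : MemLp (FunctionSpaces.Torus.stLift b ∘ θ) ∞ (volume.restrict (Ioo 0 (T - s) ×ˢ univ)) :=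
    hb₀.comp_measurePreserving hθr
  have e : FunctionSpaces.Torus.stLift (fun τ => b (s + τ)) = FunctionSpaces.Torus.stLift b ∘ θ := by
    funext p
    simp only [FunctionSpaces.Torus.stLift, hθ, Function.comp_apply]
  rw [e]
  exact hcomp

omit [DecidableEq d] in
/-- The a.e. weak divergence-freeness of the carrier passes to the shifted carrier. [folklore] -/
private theorem ae_isWeaklyDivFree_comp_add_left
    (hbdiv : ∀ᵐ t ∂(volume.restrict (Ioo 0 T)), FunctionSpaces.Torus.IsWeaklyDivFree (b t)) {s : ℝ} (hs : 0 ≤ s) :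
    ∀ᵐ τ ∂(volume.restrict (Ioo 0 (T - s))), FunctionSpaces.Torus.IsWeaklyDivFree (b (s + τ)) :=
  ae_restrict_Ioo_comp_add_left (P := fun t => FunctionSpaces.Torus.IsWeaklyDivFree (b t)) hbdiv hs (by linarith)

/-- A weak solution from a datum is a weak solution from any a.e.-equal datum (the datum enters the weak formulation only through
`∫⟪w₀, Ψ 0⟫`). [cite: LionsMagenes1972, Chap. 3 §1 (weak formulation (1.9))] -/
theorem IsWeakTensorPassiveVectorOn.congr_datum (h : IsWeakTensorPassiveVectorOn A T 𝔸 b w₀ w) (h' : w₀' =ᵐ[volume] w₀) :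
    IsWeakTensorPassiveVectorOn A T 𝔸 b w₀' w where
  aestronglyMeasurable := h.aestronglyMeasurable
  aestronglyMeasurable_carrier := h.aestronglyMeasurable_carrier
  ae_lintegral_sq_le := h.ae_lintegral_sq_le
  lintegral_carrier_lt_top := h.lintegral_carrier_lt_top
  lintegral_mul_lt_top := h.lintegral_mul_lt_top
  ae_isWeaklyDivFree_carrier := h.ae_isWeaklyDivFree_carrier
  ae_isWeaklyDivFree := h.ae_isWeaklyDivFree
  weak_eq := by
    intro Ψ hΨ hΨd
    have e : ∫ x, ⟪w₀' x, Ψ 0 x⟫_ℝ = ∫ x, ⟪w₀ x, Ψ 0 x⟫_ℝ :=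
      integral_congr_ae (h'.mono fun x hx => by simp only [hx])
    rw [e]
    exact h.weak_eq Ψ hΨ hΨd

omit [DecidableEq d] in
/-- Weak divergence-freeness is insensitive to a.e. modification. [folklore] -/
private theorem _root_.Literature.Analysis.FunctionSpaces.Torus.IsWeaklyDivFree.congr_ae' {u v : UnitAddTorus d → EuclideanSpace ℝ d}
    (hu : FunctionSpaces.Torus.IsWeaklyDivFree u) (h : v =ᵐ[volume] u) : FunctionSpaces.Torus.IsWeaklyDivFree v := by
  intro θ hθ
  rw [← hu θ hθ]
  exact integral_congr_ae (h.mono fun x hx => by simp only [hx])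

end Tools

/-! ## The propagator interface (planner ad-ideate-p4 g11's `IsPropagator`, generic) -/

/-- **THE TWO-PARAMETER PROPAGATOR SPEC.**  `U s t` is the solution map `s → t` of the linear problem
`∂_τ w + (b τ · ∇) w + ∇π = ∇·(𝔸∇w)`, `∇·w = 0` on `[0,T]`, acting on weakly divergence-free `L²` data and extended by `0` on the
`L²`-orthogonal complement of the weakly divergence-free classes (`U = S ∘ P_σ`): a contraction (`norm_le`), a cocycle (`comp`), the
identity at `t = s` on divergence-free data (`self_of_divFree`), with divergence-free range (`divFree`), vanishing on the orthogonal
complement (`eq_zero_of_orth`), continuous in `t` (`continuousOn`, weak `L²` topology: every pairing `t ↦ ⟪U s t y, z⟫` is continuous on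
`[s,T]`), and REPRESENTING every weak solution from every divergence-free `L²` datum (`repr`).
[cite: Pazy1983, Ch. 5 §5.1 Def. 5.3] [cite: DiPernaLions1989, §II.1 (12)–(14)] -/
structure IsPropagator (T : ℝ) (b : ℝ → UnitAddTorus d → EuclideanSpace ℝ d) (𝔸 : Visc4 d)
    (U : ℝ → ℝ → (Lp (EuclideanSpace ℝ d) 2 (volume : Measure (UnitAddTorus d)) →L[ℝ]
      Lp (EuclideanSpace ℝ d) 2 (volume : Measure (UnitAddTorus d)))) : Prop where
  norm_le : ∀ (s t : ℝ) (y : Lp (EuclideanSpace ℝ d) 2 (volume : Measure (UnitAddTorus d))), ‖U s t y‖ ≤ ‖y‖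
  comp : ∀ (s t r : ℝ), 0 ≤ s → s ≤ t → t ≤ r → r ≤ T →
    ∀ y : Lp (EuclideanSpace ℝ d) 2 (volume : Measure (UnitAddTorus d)), U t r (U s t y) = U s r y
  self_of_divFree : ∀ (s : ℝ), 0 ≤ s → s ≤ T → ∀ y : Lp (EuclideanSpace ℝ d) 2 (volume : Measure (UnitAddTorus d)),
    FunctionSpaces.Torus.IsWeaklyDivFree (y : UnitAddTorus d → EuclideanSpace ℝ d) → U s s y = y
  divFree : ∀ (s t : ℝ) (y : Lp (EuclideanSpace ℝ d) 2 (volume : Measure (UnitAddTorus d))),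
    FunctionSpaces.Torus.IsWeaklyDivFree ((U s t y : Lp (EuclideanSpace ℝ d) 2 volume) : UnitAddTorus d → EuclideanSpace ℝ d)
  eq_zero_of_orth : ∀ (s t : ℝ) (y : Lp (EuclideanSpace ℝ d) 2 (volume : Measure (UnitAddTorus d))),
    (∀ z : Lp (EuclideanSpace ℝ d) 2 (volume : Measure (UnitAddTorus d)),
      FunctionSpaces.Torus.IsWeaklyDivFree (z : UnitAddTorus d → EuclideanSpace ℝ d) → ⟪y, z⟫_ℝ = 0) → U s t y = 0
  continuousOn : ∀ (s : ℝ), 0 ≤ s → s ≤ T → ∀ y z : Lp (EuclideanSpace ℝ d) 2 (volume : Measure (UnitAddTorus d)),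
    ContinuousOn (fun t => ⟪U s t y, z⟫_ℝ) (Icc s T)
  repr : ∀ (s : ℝ), 0 ≤ s → s < T → ∀ (φ : UnitAddTorus d → EuclideanSpace ℝ d) (hφ : MemLp φ 2 volume),
    FunctionSpaces.Torus.IsWeaklyDivFree φ →
    ∀ w : ℝ → UnitAddTorus d → EuclideanSpace ℝ d, IsWeakTensorPassiveVectorOn 0 (T - s) 𝔸 (fun τ => b (s + τ)) φ w →
      ∀ᵐ τ ∂(volume.restrict (Ioo 0 (T - s))), ∃ hτ : MemLp (w τ) 2 volume, hτ.toLp (w τ) = U s (s + τ) (hφ.toLp φ)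

/-! ## The construction: chosen solutions, their representatives, the raw propagator -/

section Construction

variable {T : ℝ} {𝔸 : Visc4 d} {lo hi : ℝ} {b : ℝ → UnitAddTorus d → EuclideanSpace ℝ d}

/-- Existence of a weak solution on the window `[s, T)` from an `L²` divergence-free datum (Lions), along the shifted carrier.
[cite: LionsMagenes1972, Chap. 3 Thm. 1.1] -/
theorem exists_windowSol {T : ℝ} (h𝔸 : NearIso 𝔸 lo hi) (hlo : 0 < lo)
    (hb : MemLp (FunctionSpaces.Torus.stLift b) ∞ (volume.restrict (Ioo 0 T ×ˢ univ)))
    (hbdiv : ∀ᵐ t ∂(volume.restrict (Ioo 0 T)), FunctionSpaces.Torus.IsWeaklyDivFree (b t))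
    {s : ℝ} (hs : 0 ≤ s) (hsT : s < T) {φ : UnitAddTorus d → EuclideanSpace ℝ d} (hφ : MemLp φ 2 volume)
    (hφdiv : FunctionSpaces.Torus.IsWeaklyDivFree φ) :
    ∃ w : ℝ → UnitAddTorus d → EuclideanSpace ℝ d, IsWeakTensorPassiveVectorOn 0 (T - s) 𝔸 (fun τ => b (s + τ)) φ w :=
  exists_isWeakTensorPassiveVectorOn (sub_pos.2 hsT) h𝔸 hlo (memLp_top_stLift_comp_add_left hb hs)
    (ae_isWeaklyDivFree_comp_add_left hbdiv hs) hφ hφdiv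

/-- THE CHOSEN weak solution on the window `[s, T)` from the datum `φ` (Lions–Magenes weak solution). [cite: LionsMagenes1972, Chap. 3 Thm. 1.1] -/
def windowSol (h𝔸 : NearIso 𝔸 lo hi) (hlo : 0 < lo)
    (hb : MemLp (FunctionSpaces.Torus.stLift b) ∞ (volume.restrict (Ioo 0 T ×ˢ univ)))
    (hbdiv : ∀ᵐ t ∂(volume.restrict (Ioo 0 T)), FunctionSpaces.Torus.IsWeaklyDivFree (b t))
    {s : ℝ} (hs : 0 ≤ s) (hsT : s < T) {φ : UnitAddTorus d → EuclideanSpace ℝ d} (hφ : MemLp φ 2 volume)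
    (hφdiv : FunctionSpaces.Torus.IsWeaklyDivFree φ) : ℝ → UnitAddTorus d → EuclideanSpace ℝ d :=
  Classical.choose (exists_windowSol h𝔸 hlo hb hbdiv hs hsT hφ hφdiv)

/-- The chosen window solution is a weak solution. [cite: LionsMagenes1972, Chap. 3 Thm. 1.1] -/
theorem windowSol_spec (h𝔸 : NearIso 𝔸 lo hi) (hlo : 0 < lo)
    (hb : MemLp (FunctionSpaces.Torus.stLift b) ∞ (volume.restrict (Ioo 0 T ×ˢ univ)))
    (hbdiv : ∀ᵐ t ∂(volume.restrict (Ioo 0 T)), FunctionSpaces.Torus.IsWeaklyDivFree (b t))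
    {s : ℝ} (hs : 0 ≤ s) (hsT : s < T) {φ : UnitAddTorus d → EuclideanSpace ℝ d} (hφ : MemLp φ 2 volume)
    (hφdiv : FunctionSpaces.Torus.IsWeaklyDivFree φ) :
    IsWeakTensorPassiveVectorOn 0 (T - s) 𝔸 (fun τ => b (s + τ)) φ (windowSol h𝔸 hlo hb hbdiv hs hsT hφ hφdiv) :=
  Classical.choose_spec (exists_windowSol h𝔸 hlo hb hbdiv hs hsT hφ hφdiv)

variable [Nonempty d]

/-- THE weakly continuous representative of the chosen window solution (`PassiveVectorTensorRepresentative`).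
[cite: Temam1984, Ch. III §1 Lemma 1.4] -/
def windowRep (h𝔸 : NearIso 𝔸 lo hi) (hlo : 0 < lo)
    (hb : MemLp (FunctionSpaces.Torus.stLift b) ∞ (volume.restrict (Ioo 0 T ×ˢ univ)))
    (hbdiv : ∀ᵐ t ∂(volume.restrict (Ioo 0 T)), FunctionSpaces.Torus.IsWeaklyDivFree (b t))
    {s : ℝ} (hs : 0 ≤ s) (hsT : s < T) {φ : UnitAddTorus d → EuclideanSpace ℝ d} (hφ : MemLp φ 2 volume)
    (hφdiv : FunctionSpaces.Torus.IsWeaklyDivFree φ) : ℝ → UnitAddTorus d → EuclideanSpace ℝ d :=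
  Classical.choose ((windowSol_spec h𝔸 hlo hb hbdiv hs hsT hφ hφdiv).exists_weaklyContinuous_representative
    (sub_pos.2 hsT) hφ hφdiv)

/-- The defining properties of the representative of the chosen window solution. [cite: DeLellisSzekelyhidi2010, Lemma 7.1] -/
theorem windowRep_spec (h𝔸 : NearIso 𝔸 lo hi) (hlo : 0 < lo)
    (hb : MemLp (FunctionSpaces.Torus.stLift b) ∞ (volume.restrict (Ioo 0 T ×ˢ univ)))
    (hbdiv : ∀ᵐ t ∂(volume.restrict (Ioo 0 T)), FunctionSpaces.Torus.IsWeaklyDivFree (b t))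
    {s : ℝ} (hs : 0 ≤ s) (hsT : s < T) {φ : UnitAddTorus d → EuclideanSpace ℝ d} (hφ : MemLp φ 2 volume)
    (hφdiv : FunctionSpaces.Torus.IsWeaklyDivFree φ) :
    let w := windowSol h𝔸 hlo hb hbdiv hs hsT hφ hφdiv
    let W := windowRep h𝔸 hlo hb hbdiv hs hsT hφ hφdiv
    (∀ t, 0 ≤ t → MemLp (W t) 2 volume) ∧
      (∃ C : ℝ≥0, ∀ t, 0 ≤ t → ∫ x, ‖W t x‖ ^ 2 ≤ C) ∧
      (∀ M : ℝ, (∀ᵐ t ∂(volume.restrict (Ioo 0 (T - s))), ∫ x, ‖w t x‖ ^ 2 ≤ M) →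
        ∀ t ∈ Icc 0 (T - s), ∫ x, ‖W t x‖ ^ 2 ≤ M) ∧
      (∀ᵐ t ∂(volume.restrict (Ioo 0 (T - s))), W t =ᵐ[volume] w t) ∧
      (W 0 =ᵐ[volume] φ) ∧
      (∀ ψ : UnitAddTorus d → EuclideanSpace ℝ d, MemLp ψ 2 volume →
        ContinuousOn (fun t => ∫ x, ⟪W t x, ψ x⟫_ℝ) (Icc 0 (T - s))) ∧
      (∀ t ∈ Icc 0 (T - s), FunctionSpaces.Torus.IsWeaklyDivFree (W t)) ∧
      (∀ G : UnitAddTorus d → EuclideanSpace ℝ d, FunctionSpaces.Torus.IsSmooth G → FunctionSpaces.Torus.IsDivFree G →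
        ∀ σ ∈ Icc 0 (T - s), ∫ x, ⟪W σ x, G x⟫_ℝ = (∫ x, ⟪φ x, G x⟫_ℝ) +
          ∫ τ in Ioc 0 σ, ((∫ x, ⟪w τ x, FunctionSpaces.Torus.convect (b (s + τ)) G x + viscAdj 𝔸 G x⟫_ℝ) +
            0 * ∫ x, ⟪b (s + τ) x, FunctionSpaces.Torus.convect (w τ) G x⟫_ℝ)) :=
  Classical.choose_spec ((windowSol_spec h𝔸 hlo hb hbdiv hs hsT hφ hφdiv).exists_weaklyContinuous_representative
    (sub_pos.2 hsT) hφ hφdiv)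

/-- The representative is in `L²` at every time `τ ≥ 0`. [cite: Temam1984, Ch. III §1 Lemma 1.4] -/
theorem memLp_windowRep (h𝔸 : NearIso 𝔸 lo hi) (hlo : 0 < lo)
    (hb : MemLp (FunctionSpaces.Torus.stLift b) ∞ (volume.restrict (Ioo 0 T ×ˢ univ)))
    (hbdiv : ∀ᵐ t ∂(volume.restrict (Ioo 0 T)), FunctionSpaces.Torus.IsWeaklyDivFree (b t))
    {s : ℝ} (hs : 0 ≤ s) (hsT : s < T) {φ : UnitAddTorus d → EuclideanSpace ℝ d} (hφ : MemLp φ 2 volume)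
    (hφdiv : FunctionSpaces.Torus.IsWeaklyDivFree φ) {τ : ℝ} (hτ : 0 ≤ τ) :
    MemLp (windowRep h𝔸 hlo hb hbdiv hs hsT hφ hφdiv τ) 2 volume :=
  (windowRep_spec h𝔸 hlo hb hbdiv hs hsT hφ hφdiv).1 τ hτ

/-- **Contraction at every time**: `∫‖W τ‖² ≤ ∫‖φ‖²` for every `τ ∈ [0, T − s]` (energy inequality + every-time transfer).
[cite: Temam1984, Ch. III §1 Lemma 1.2] -/
theorem integral_norm_sq_windowRep_le (h𝔸 : NearIso 𝔸 lo hi) (hlo : 0 < lo)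
    (hb : MemLp (FunctionSpaces.Torus.stLift b) ∞ (volume.restrict (Ioo 0 T ×ˢ univ)))
    (hbdiv : ∀ᵐ t ∂(volume.restrict (Ioo 0 T)), FunctionSpaces.Torus.IsWeaklyDivFree (b t))
    {s : ℝ} (hs : 0 ≤ s) (hsT : s < T) {φ : UnitAddTorus d → EuclideanSpace ℝ d} (hφ : MemLp φ 2 volume)
    (hφdiv : FunctionSpaces.Torus.IsWeaklyDivFree φ) {τ : ℝ} (hτ : τ ∈ Icc 0 (T - s)) :
    ∫ x, ‖windowRep h𝔸 hlo hb hbdiv hs hsT hφ hφdiv τ x‖ ^ 2 ≤ ∫ x, ‖φ x‖ ^ 2 :=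
  (windowRep_spec h𝔸 hlo hb hbdiv hs hsT hφ hφdiv).2.2.1 _
    ((windowSol_spec h𝔸 hlo hb hbdiv hs hsT hφ hφdiv).ae_integral_norm_sq_le h𝔸 hlo hφ hφdiv
      (memLp_top_stLift_comp_add_left hb hs)) τ hτ

/-- **Well-definedness**: two `L²` divergence-free data that agree a.e. give representatives that agree a.e. at EVERY time
`τ ∈ [0, T − s]` (datum congruence + uniqueness of weak solutions + uniqueness of weakly continuous representatives).
[cite: Temam1984, Ch. III §1 Lemma 1.4] -/
theorem windowRep_congr (h𝔸 : NearIso 𝔸 lo hi) (hlo : 0 < lo)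
    (hb : MemLp (FunctionSpaces.Torus.stLift b) ∞ (volume.restrict (Ioo 0 T ×ˢ univ)))
    (hbdiv : ∀ᵐ t ∂(volume.restrict (Ioo 0 T)), FunctionSpaces.Torus.IsWeaklyDivFree (b t))
    {s : ℝ} (hs : 0 ≤ s) (hsT : s < T) {φ φ' : UnitAddTorus d → EuclideanSpace ℝ d} (hφ : MemLp φ 2 volume)
    (hφdiv : FunctionSpaces.Torus.IsWeaklyDivFree φ) (hφ' : MemLp φ' 2 volume)
    (hφ'div : FunctionSpaces.Torus.IsWeaklyDivFree φ') (heq : φ' =ᵐ[volume] φ) :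
    ∀ τ ∈ Icc 0 (T - s), windowRep h𝔸 hlo hb hbdiv hs hsT hφ' hφ'div τ =ᵐ[volume] windowRep h𝔸 hlo hb hbdiv hs hsT hφ hφdiv τ := by
  have R := windowRep_spec h𝔸 hlo hb hbdiv hs hsT hφ hφdiv
  have R' := windowRep_spec h𝔸 hlo hb hbdiv hs hsT hφ' hφ'div
  exact IsWeakTensorPassiveVectorOn.representative_ae_eq (sub_pos.2 hsT) h𝔸 hlo
    ((windowSol_spec h𝔸 hlo hb hbdiv hs hsT hφ' hφ'div).congr_datum heq.symm)
    (windowSol_spec h𝔸 hlo hb hbdiv hs hsT hφ hφdiv)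
    (memLp_top_stLift_comp_add_left hb hs)
    (fun t ht => R'.1 t ht.1) (fun t ht => R.1 t ht.1) R'.2.2.2.2.2.1 R.2.2.2.2.2.1 R'.2.2.2.1 R.2.2.2.1

/-! ## The raw window map on `L²` and its packaging as a continuous linear map -/

omit [DecidableEq d] [Nonempty d] in
/-- `‖y‖² = ∫ ‖y‖²` for an `L²` class. [folklore] -/
private theorem norm_sq_eq_integral (y : Lp (EuclideanSpace ℝ d) 2 (volume : Measure (UnitAddTorus d))) :
    ‖y‖ ^ 2 = ∫ x, ‖(y : UnitAddTorus d → EuclideanSpace ℝ d) x‖ ^ 2 := by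
  rw [← real_inner_self_eq_norm_sq, MeasureTheory.L2.inner_def]
  exact integral_congr_ae (Eventually.of_forall fun x => real_inner_self_eq_norm_sq _)

omit [DecidableEq d] [Nonempty d] in
/-- `‖toLp f‖² = ∫ ‖f‖²` for `f ∈ L²`. [folklore] -/
private theorem norm_toLp_sq {f : UnitAddTorus d → EuclideanSpace ℝ d} (hf : MemLp f 2 volume) :
    ‖hf.toLp f‖ ^ 2 = ∫ x, ‖f x‖ ^ 2 := by
  rw [norm_sq_eq_integral]
  exact integral_congr_ae (hf.coeFn_toLp.mono fun x hx => by simp only [hx])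

omit [DecidableEq d] [Nonempty d] in
/-- The sum of two weakly divergence-free `L²` fields is weakly divergence free. [folklore] -/
private theorem isWeaklyDivFree_add {u v : UnitAddTorus d → EuclideanSpace ℝ d} (hu : MemLp u 2 volume) (hv : MemLp v 2 volume)
    (hud : FunctionSpaces.Torus.IsWeaklyDivFree u) (hvd : FunctionSpaces.Torus.IsWeaklyDivFree v) :
    FunctionSpaces.Torus.IsWeaklyDivFree (fun x => u x + v x) := by
  intro θ hθ
  have hg : MemLp (FunctionSpaces.Torus.gradient θ) 2 volume := (FunctionSpaces.Torus.IsSmooth.gradient hθ).memLp 2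
  have e : ∫ x, ⟪u x + v x, FunctionSpaces.Torus.gradient θ x⟫_ℝ =
      (∫ x, ⟪u x, FunctionSpaces.Torus.gradient θ x⟫_ℝ) + ∫ x, ⟪v x, FunctionSpaces.Torus.gradient θ x⟫_ℝ := by
    rw [← integral_add (integrable_inner_of_memLp_two_vec' hu hg) (integrable_inner_of_memLp_two_vec' hv hg)]
    exact integral_congr_ae (ae_of_all _ fun x => inner_add_left _ _ _)
  rw [e, hud θ hθ, hvd θ hθ, add_zero]
where
  /-- `⟪f, g⟫` is integrable for `f, g ∈ L²`. -/
  integrable_inner_of_memLp_two_vec' {f g : UnitAddTorus d → EuclideanSpace ℝ d} (hf : MemLp f 2 volume)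
      (hg : MemLp g 2 volume) : Integrable (fun x => ⟪f x, g x⟫_ℝ) volume := by
    have h : MemLp ((fun x => ‖g x‖) * fun x => ‖f x‖) 1 volume := hf.norm.mul hg.norm
    refine (memLp_one_iff_integrable.1 h).mono' (hf.1.inner hg.1) (Eventually.of_forall fun x => ?_)
    rw [Pi.mul_apply, Real.norm_eq_abs, mul_comm]
    exact abs_real_inner_le_norm _ _

omit [DecidableEq d] [Nonempty d] in
/-- A scalar multiple of a weakly divergence-free `L²` field is weakly divergence free. [folklore] -/
private theorem isWeaklyDivFree_smul {u : UnitAddTorus d → EuclideanSpace ℝ d} (a : ℝ)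
    (hud : FunctionSpaces.Torus.IsWeaklyDivFree u) : FunctionSpaces.Torus.IsWeaklyDivFree (fun x => a • u x) := by
  intro θ hθ
  have e : ∫ x, ⟪a • u x, FunctionSpaces.Torus.gradient θ x⟫_ℝ = a * ∫ x, ⟪u x, FunctionSpaces.Torus.gradient θ x⟫_ℝ := by
    rw [← integral_const_mul]
    exact integral_congr_ae (ae_of_all _ fun x => by simp only [real_inner_smul_left])
  rw [e, hud θ hθ, mul_zero]

omit [DecidableEq d] [Nonempty d] in
/-- The σ-projection of a class is weakly divergence free (Helmholtz–Leray decomposition of `L²`). [cite: Temam1984, Ch. I §1.4 Thm. 1.4] -/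
theorem isWeaklyDivFree_starProjection (y : Lp (EuclideanSpace ℝ d) 2 (volume : Measure (UnitAddTorus d))) :
    FunctionSpaces.Torus.IsWeaklyDivFree
      (((divFreeL2 d).starProjection y : Lp (EuclideanSpace ℝ d) 2 volume) : UnitAddTorus d → EuclideanSpace ℝ d) :=
  (mem_divFreeL2_iff _).1 ((divFreeL2 d).starProjection_apply_mem y)

/-- THE RAW WINDOW MAP at lag `τ ∈ [0, T − s]`: `y ↦` the class of the representative, at time `τ`, of the chosen weak solution on
`[s, T)` from the datum `P_σ y`. [cite: Pazy1983, Ch. 5 §5.1 Def. 5.3] -/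
def windowMapFun (h𝔸 : NearIso 𝔸 lo hi) (hlo : 0 < lo)
    (hb : MemLp (FunctionSpaces.Torus.stLift b) ∞ (volume.restrict (Ioo 0 T ×ˢ univ)))
    (hbdiv : ∀ᵐ t ∂(volume.restrict (Ioo 0 T)), FunctionSpaces.Torus.IsWeaklyDivFree (b t))
    {s : ℝ} (hs : 0 ≤ s) (hsT : s < T) {τ : ℝ} (hτ : 0 ≤ τ)
    (y : Lp (EuclideanSpace ℝ d) 2 (volume : Measure (UnitAddTorus d))) :
    Lp (EuclideanSpace ℝ d) 2 (volume : Measure (UnitAddTorus d)) :=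
  (memLp_windowRep h𝔸 hlo hb hbdiv hs hsT (Lp.memLp ((divFreeL2 d).starProjection y))
    (isWeaklyDivFree_starProjection y) hτ).toLp
      (windowRep h𝔸 hlo hb hbdiv hs hsT (Lp.memLp ((divFreeL2 d).starProjection y)) (isWeaklyDivFree_starProjection y) τ)

/-- The raw window map is additive (superposition + uniqueness of weak solutions and of their representatives).
[cite: DiPernaLions1989, §II.1 (12)–(14)] -/
theorem windowMapFun_add (h𝔸 : NearIso 𝔸 lo hi) (hlo : 0 < lo)
    (hb : MemLp (FunctionSpaces.Torus.stLift b) ∞ (volume.restrict (Ioo 0 T ×ˢ univ)))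
    (hbdiv : ∀ᵐ t ∂(volume.restrict (Ioo 0 T)), FunctionSpaces.Torus.IsWeaklyDivFree (b t))
    {s : ℝ} (hs : 0 ≤ s) (hsT : s < T) {τ : ℝ} (hτ : τ ∈ Icc 0 (T - s))
    (y z : Lp (EuclideanSpace ℝ d) 2 (volume : Measure (UnitAddTorus d))) :
    windowMapFun h𝔸 hlo hb hbdiv hs hsT hτ.1 (y + z) =
      windowMapFun h𝔸 hlo hb hbdiv hs hsT hτ.1 y + windowMapFun h𝔸 hlo hb hbdiv hs hsT hτ.1 z := by
  set P := (divFreeL2 d).starProjection with hP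
  -- data
  have hy : MemLp ((P y : Lp (EuclideanSpace ℝ d) 2 volume) : UnitAddTorus d → EuclideanSpace ℝ d) 2 volume := Lp.memLp _
  have hz : MemLp ((P z : Lp (EuclideanSpace ℝ d) 2 volume) : UnitAddTorus d → EuclideanSpace ℝ d) 2 volume := Lp.memLp _
  have hyz : MemLp ((P (y + z) : Lp (EuclideanSpace ℝ d) 2 volume) : UnitAddTorus d → EuclideanSpace ℝ d) 2 volume := Lp.memLp _
  have hyd := isWeaklyDivFree_starProjection (d := d) y
  have hzd := isWeaklyDivFree_starProjection (d := d) z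
  have hyzd := isWeaklyDivFree_starProjection (d := d) (y + z)
  -- the sum datum, as a function
  have hsum : MemLp (fun x => ((P y : Lp (EuclideanSpace ℝ d) 2 volume) : UnitAddTorus d → EuclideanSpace ℝ d) x +
      ((P z : Lp (EuclideanSpace ℝ d) 2 volume) : UnitAddTorus d → EuclideanSpace ℝ d) x) 2 volume := hy.add hz
  have hsumd := isWeaklyDivFree_add hy hz hyd hzd
  have hae : ((P (y + z) : Lp (EuclideanSpace ℝ d) 2 volume) : UnitAddTorus d → EuclideanSpace ℝ d) =ᵐ[volume]
      fun x => ((P y : Lp (EuclideanSpace ℝ d) 2 volume) : UnitAddTorus d → EuclideanSpace ℝ d) x +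
        ((P z : Lp (EuclideanSpace ℝ d) 2 volume) : UnitAddTorus d → EuclideanSpace ℝ d) x := by
    rw [hP, map_add]
    exact Lp.coeFn_add _ _
  -- representative of the chosen solution for `P(y+z)` vs for the function sum
  have h1 := windowRep_congr h𝔸 hlo hb hbdiv hs hsT hsum hsumd hyz hyzd hae τ hτ
  -- representative for the function sum vs sum of representatives
  have Ry := windowRep_spec h𝔸 hlo hb hbdiv hs hsT hy hyd
  have Rz := windowRep_spec h𝔸 hlo hb hbdiv hs hsT hz hzd
  have Rs := windowRep_spec h𝔸 hlo hb hbdiv hs hsT hsum hsumd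
  have h2 := IsWeakTensorPassiveVectorOn.representative_add (sub_pos.2 hsT) h𝔸 hlo
    (windowSol_spec h𝔸 hlo hb hbdiv hs hsT hy hyd) (windowSol_spec h𝔸 hlo hb hbdiv hs hsT hz hzd)
    (windowSol_spec h𝔸 hlo hb hbdiv hs hsT hsum hsumd) (hy.integrable one_le_two) (hz.integrable one_le_two)
    (memLp_top_stLift_comp_add_left hb hs)
    (fun t ht => Ry.1 t ht.1) (fun t ht => Rz.1 t ht.1) (fun t ht => Rs.1 t ht.1)
    Ry.2.2.2.2.2.1 Rz.2.2.2.2.2.1 Rs.2.2.2.2.2.1 Ry.2.2.2.1 Rz.2.2.2.1 Rs.2.2.2.1 τ hτ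
  -- assemble in `Lp`
  unfold windowMapFun
  rw [← MemLp.toLp_add]
  exact MemLp.toLp_congr _ _ (h1.trans h2)

/-- The raw window map is homogeneous. [cite: DiPernaLions1989, §II.1 (12)–(14)] -/
theorem windowMapFun_smul (h𝔸 : NearIso 𝔸 lo hi) (hlo : 0 < lo)
    (hb : MemLp (FunctionSpaces.Torus.stLift b) ∞ (volume.restrict (Ioo 0 T ×ˢ univ)))
    (hbdiv : ∀ᵐ t ∂(volume.restrict (Ioo 0 T)), FunctionSpaces.Torus.IsWeaklyDivFree (b t))
    {s : ℝ} (hs : 0 ≤ s) (hsT : s < T) {τ : ℝ} (hτ : τ ∈ Icc 0 (T - s)) (a : ℝ)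
    (y : Lp (EuclideanSpace ℝ d) 2 (volume : Measure (UnitAddTorus d))) :
    windowMapFun h𝔸 hlo hb hbdiv hs hsT hτ.1 (a • y) = a • windowMapFun h𝔸 hlo hb hbdiv hs hsT hτ.1 y := by
  set P := (divFreeL2 d).starProjection with hP
  have hy : MemLp ((P y : Lp (EuclideanSpace ℝ d) 2 volume) : UnitAddTorus d → EuclideanSpace ℝ d) 2 volume := Lp.memLp _
  have hay : MemLp ((P (a • y) : Lp (EuclideanSpace ℝ d) 2 volume) : UnitAddTorus d → EuclideanSpace ℝ d) 2 volume := Lp.memLp _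
  have hyd := isWeaklyDivFree_starProjection (d := d) y
  have hayd := isWeaklyDivFree_starProjection (d := d) (a • y)
  have hsm : MemLp (fun x => a • ((P y : Lp (EuclideanSpace ℝ d) 2 volume) : UnitAddTorus d → EuclideanSpace ℝ d) x) 2 volume :=
    hy.const_smul a
  have hsmd := isWeaklyDivFree_smul a hyd
  have hae : ((P (a • y) : Lp (EuclideanSpace ℝ d) 2 volume) : UnitAddTorus d → EuclideanSpace ℝ d) =ᵐ[volume]
      fun x => a • ((P y : Lp (EuclideanSpace ℝ d) 2 volume) : UnitAddTorus d → EuclideanSpace ℝ d) x := by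
    rw [hP, map_smul]
    exact Lp.coeFn_smul _ _
  have h1 := windowRep_congr h𝔸 hlo hb hbdiv hs hsT hsm hsmd hay hayd hae τ hτ
  have Ry := windowRep_spec h𝔸 hlo hb hbdiv hs hsT hy hyd
  have Rs := windowRep_spec h𝔸 hlo hb hbdiv hs hsT hsm hsmd
  have h2 := IsWeakTensorPassiveVectorOn.representative_smul (sub_pos.2 hsT) h𝔸 hlo a
    (windowSol_spec h𝔸 hlo hb hbdiv hs hsT hy hyd) (windowSol_spec h𝔸 hlo hb hbdiv hs hsT hsm hsmd)
    (memLp_top_stLift_comp_add_left hb hs)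
    (fun t ht => Ry.1 t ht.1) (fun t ht => Rs.1 t ht.1) Ry.2.2.2.2.2.1 Rs.2.2.2.2.2.1 Ry.2.2.2.1 Rs.2.2.2.1 τ hτ
  unfold windowMapFun
  rw [← MemLp.toLp_const_smul]
  exact MemLp.toLp_congr _ _ (h1.trans h2)

/-- The raw window map is a contraction: `‖W τ‖ ≤ ‖P_σ y‖ ≤ ‖y‖`. [cite: Temam1984, Ch. III §1 Lemma 1.2] -/
theorem norm_windowMapFun_le (h𝔸 : NearIso 𝔸 lo hi) (hlo : 0 < lo)
    (hb : MemLp (FunctionSpaces.Torus.stLift b) ∞ (volume.restrict (Ioo 0 T ×ˢ univ)))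
    (hbdiv : ∀ᵐ t ∂(volume.restrict (Ioo 0 T)), FunctionSpaces.Torus.IsWeaklyDivFree (b t))
    {s : ℝ} (hs : 0 ≤ s) (hsT : s < T) {τ : ℝ} (hτ : τ ∈ Icc 0 (T - s))
    (y : Lp (EuclideanSpace ℝ d) 2 (volume : Measure (UnitAddTorus d))) :
    ‖windowMapFun h𝔸 hlo hb hbdiv hs hsT hτ.1 y‖ ≤ ‖y‖ := by
  have hy : MemLp (((divFreeL2 d).starProjection y : Lp (EuclideanSpace ℝ d) 2 volume) : UnitAddTorus d → EuclideanSpace ℝ d)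
      2 volume := Lp.memLp _
  have h1 : ‖windowMapFun h𝔸 hlo hb hbdiv hs hsT hτ.1 y‖ ^ 2 ≤ ‖(divFreeL2 d).starProjection y‖ ^ 2 := by
    unfold windowMapFun
    rw [norm_toLp_sq, norm_sq_eq_integral]
    exact integral_norm_sq_windowRep_le h𝔸 hlo hb hbdiv hs hsT hy (isWeaklyDivFree_starProjection y) hτ
  have h2 : ‖(divFreeL2 d).starProjection y‖ ≤ ‖y‖ := (divFreeL2 d).norm_starProjection_apply_le y
  have h3 : ‖windowMapFun h𝔸 hlo hb hbdiv hs hsT hτ.1 y‖ ≤ ‖(divFreeL2 d).starProjection y‖ :=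
    (abs_le_of_sq_le_sq' h1 (norm_nonneg _)).2
  exact h3.trans h2

/-- THE WINDOW MAP as a continuous linear map of `L²` (lag `τ ∈ [0, T − s]`). [cite: Pazy1983, Ch. 5 §5.1 Def. 5.3] -/
def windowMap (h𝔸 : NearIso 𝔸 lo hi) (hlo : 0 < lo)
    (hb : MemLp (FunctionSpaces.Torus.stLift b) ∞ (volume.restrict (Ioo 0 T ×ˢ univ)))
    (hbdiv : ∀ᵐ t ∂(volume.restrict (Ioo 0 T)), FunctionSpaces.Torus.IsWeaklyDivFree (b t))
    {s : ℝ} (hs : 0 ≤ s) (hsT : s < T) {τ : ℝ} (hτ : τ ∈ Icc 0 (T - s)) :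
    Lp (EuclideanSpace ℝ d) 2 (volume : Measure (UnitAddTorus d)) →L[ℝ] Lp (EuclideanSpace ℝ d) 2 (volume : Measure (UnitAddTorus d)) :=
  LinearMap.mkContinuous
    { toFun := windowMapFun h𝔸 hlo hb hbdiv hs hsT hτ.1
      map_add' := windowMapFun_add h𝔸 hlo hb hbdiv hs hsT hτ
      map_smul' := windowMapFun_smul h𝔸 hlo hb hbdiv hs hsT hτ } 1
    fun y => by rw [one_mul]; exact norm_windowMapFun_le h𝔸 hlo hb hbdiv hs hsT hτ y

/-- The window map applied (definitional). [folklore] -/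
private theorem windowMap_apply (h𝔸 : NearIso 𝔸 lo hi) (hlo : 0 < lo)
    (hb : MemLp (FunctionSpaces.Torus.stLift b) ∞ (volume.restrict (Ioo 0 T ×ˢ univ)))
    (hbdiv : ∀ᵐ t ∂(volume.restrict (Ioo 0 T)), FunctionSpaces.Torus.IsWeaklyDivFree (b t))
    {s : ℝ} (hs : 0 ≤ s) (hsT : s < T) {τ : ℝ} (hτ : τ ∈ Icc 0 (T - s))
    (y : Lp (EuclideanSpace ℝ d) 2 (volume : Measure (UnitAddTorus d))) :
    windowMap h𝔸 hlo hb hbdiv hs hsT hτ y = windowMapFun h𝔸 hlo hb hbdiv hs hsT hτ.1 y := rfl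

/-! ## The propagator and its properties -/

omit [DecidableEq d] [Nonempty d] in
/-- The zero field is weakly divergence free. [folklore] -/
private theorem isWeaklyDivFree_zero' : FunctionSpaces.Torus.IsWeaklyDivFree (fun _ : UnitAddTorus d => (0 : EuclideanSpace ℝ d)) := by
  intro θ hθ
  simp

/-- Changing the lag along an equality (the lag enters dependent proof terms). [folklore] -/
private theorem windowMapFun_congr_lag (h𝔸 : NearIso 𝔸 lo hi) (hlo : 0 < lo)
    (hb : MemLp (FunctionSpaces.Torus.stLift b) ∞ (volume.restrict (Ioo 0 T ×ˢ univ)))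
    (hbdiv : ∀ᵐ t ∂(volume.restrict (Ioo 0 T)), FunctionSpaces.Torus.IsWeaklyDivFree (b t))
    {s : ℝ} (hs : 0 ≤ s) (hsT : s < T) {τ τ' : ℝ} (hτ : 0 ≤ τ) (hτ' : 0 ≤ τ') (h : τ = τ')
    (y : Lp (EuclideanSpace ℝ d) 2 (volume : Measure (UnitAddTorus d))) :
    windowMapFun h𝔸 hlo hb hbdiv hs hsT hτ y = windowMapFun h𝔸 hlo hb hbdiv hs hsT hτ' y := by
  subst h
  rfl

/-- The raw window map only sees the σ-projection of its argument. [folklore] -/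
private theorem windowMapFun_starProjection (h𝔸 : NearIso 𝔸 lo hi) (hlo : 0 < lo)
    (hb : MemLp (FunctionSpaces.Torus.stLift b) ∞ (volume.restrict (Ioo 0 T ×ˢ univ)))
    (hbdiv : ∀ᵐ t ∂(volume.restrict (Ioo 0 T)), FunctionSpaces.Torus.IsWeaklyDivFree (b t))
    {s : ℝ} (hs : 0 ≤ s) (hsT : s < T) {τ : ℝ} (hτ : τ ∈ Icc 0 (T - s))
    (y : Lp (EuclideanSpace ℝ d) 2 (volume : Measure (UnitAddTorus d))) :
    windowMapFun h𝔸 hlo hb hbdiv hs hsT hτ.1 ((divFreeL2 d).starProjection y) = windowMapFun h𝔸 hlo hb hbdiv hs hsT hτ.1 y := by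
  set P := (divFreeL2 d).starProjection with hP
  have e : P (P y) = P y := Submodule.starProjection_eq_self_iff.2 ((divFreeL2 d).starProjection_apply_mem y)
  have hy : MemLp ((P y : Lp (EuclideanSpace ℝ d) 2 volume) : UnitAddTorus d → EuclideanSpace ℝ d) 2 volume := Lp.memLp _
  have hPy : MemLp ((P (P y) : Lp (EuclideanSpace ℝ d) 2 volume) : UnitAddTorus d → EuclideanSpace ℝ d) 2 volume := Lp.memLp _
  have hae : ((P (P y) : Lp (EuclideanSpace ℝ d) 2 volume) : UnitAddTorus d → EuclideanSpace ℝ d) =ᵐ[volume]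
      ((P y : Lp (EuclideanSpace ℝ d) 2 volume) : UnitAddTorus d → EuclideanSpace ℝ d) := by
    rw [e]
  unfold windowMapFun
  exact MemLp.toLp_congr _ _ (windowRep_congr h𝔸 hlo hb hbdiv hs hsT hy (isWeaklyDivFree_starProjection y) hPy
    (isWeaklyDivFree_starProjection (P y)) hae τ hτ)

open Classical in
/-- **THE PROPAGATOR** `U s t`: the window map at lag `t − s` for `0 ≤ s < T`, `s ≤ t ≤ T`; the σ-projection at `s = t = T`; `0` otherwise.
[cite: Pazy1983, Ch. 5 §5.1 Def. 5.3] -/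
def propagator (h𝔸 : NearIso 𝔸 lo hi) (hlo : 0 < lo)
    (hb : MemLp (FunctionSpaces.Torus.stLift b) ∞ (volume.restrict (Ioo 0 T ×ˢ univ)))
    (hbdiv : ∀ᵐ t ∂(volume.restrict (Ioo 0 T)), FunctionSpaces.Torus.IsWeaklyDivFree (b t)) (s t : ℝ) :
    Lp (EuclideanSpace ℝ d) 2 (volume : Measure (UnitAddTorus d)) →L[ℝ] Lp (EuclideanSpace ℝ d) 2 (volume : Measure (UnitAddTorus d)) :=
  if h : 0 ≤ s ∧ s < T ∧ s ≤ t ∧ t ≤ T then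
    windowMap h𝔸 hlo hb hbdiv h.1 h.2.1 (τ := t - s) ⟨sub_nonneg.2 h.2.2.1, sub_le_sub_right h.2.2.2 s⟩
  else if s = T ∧ t = T then (divFreeL2 d).starProjection else 0

/-- The propagator inside the window: the window map at lag `t − s`. [folklore] -/
private theorem propagator_apply_of_mem (h𝔸 : NearIso 𝔸 lo hi) (hlo : 0 < lo)
    (hb : MemLp (FunctionSpaces.Torus.stLift b) ∞ (volume.restrict (Ioo 0 T ×ˢ univ)))
    (hbdiv : ∀ᵐ t ∂(volume.restrict (Ioo 0 T)), FunctionSpaces.Torus.IsWeaklyDivFree (b t))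
    {s t : ℝ} (hs : 0 ≤ s) (hsT : s < T) (hst : s ≤ t) (htT : t ≤ T)
    (y : Lp (EuclideanSpace ℝ d) 2 (volume : Measure (UnitAddTorus d))) :
    propagator h𝔸 hlo hb hbdiv s t y = windowMapFun h𝔸 hlo hb hbdiv hs hsT (sub_nonneg.2 hst) (τ := t - s) y := by
  have h : 0 ≤ s ∧ s < T ∧ s ≤ t ∧ t ≤ T := ⟨hs, hsT, hst, htT⟩
  unfold propagator
  rw [dif_pos h]
  rfl

/-- The propagator at the terminal instant is the σ-projection. [folklore] -/
private theorem propagator_apply_top (h𝔸 : NearIso 𝔸 lo hi) (hlo : 0 < lo)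
    (hb : MemLp (FunctionSpaces.Torus.stLift b) ∞ (volume.restrict (Ioo 0 T ×ˢ univ)))
    (hbdiv : ∀ᵐ t ∂(volume.restrict (Ioo 0 T)), FunctionSpaces.Torus.IsWeaklyDivFree (b t))
    (y : Lp (EuclideanSpace ℝ d) 2 (volume : Measure (UnitAddTorus d))) :
    propagator h𝔸 hlo hb hbdiv T T y = (divFreeL2 d).starProjection y := by
  unfold propagator
  rw [dif_neg (fun h => lt_irrefl _ h.2.1), if_pos ⟨rfl, rfl⟩]

/-- The propagator vanishes outside the admissible range. [folklore] -/
private theorem propagator_apply_of_not (h𝔸 : NearIso 𝔸 lo hi) (hlo : 0 < lo)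
    (hb : MemLp (FunctionSpaces.Torus.stLift b) ∞ (volume.restrict (Ioo 0 T ×ˢ univ)))
    (hbdiv : ∀ᵐ t ∂(volume.restrict (Ioo 0 T)), FunctionSpaces.Torus.IsWeaklyDivFree (b t))
    {s t : ℝ} (h1 : ¬ (0 ≤ s ∧ s < T ∧ s ≤ t ∧ t ≤ T)) (h2 : ¬ (s = T ∧ t = T))
    (y : Lp (EuclideanSpace ℝ d) 2 (volume : Measure (UnitAddTorus d))) :
    propagator h𝔸 hlo hb hbdiv s t y = 0 := by
  unfold propagator
  rw [dif_neg h1, if_neg h2]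
  rfl

/-- Inside the window the propagator's value is (a.e.) the representative of the chosen solution. [folklore] -/
private theorem coeFn_propagator_ae_eq (h𝔸 : NearIso 𝔸 lo hi) (hlo : 0 < lo)
    (hb : MemLp (FunctionSpaces.Torus.stLift b) ∞ (volume.restrict (Ioo 0 T ×ˢ univ)))
    (hbdiv : ∀ᵐ t ∂(volume.restrict (Ioo 0 T)), FunctionSpaces.Torus.IsWeaklyDivFree (b t))
    {s t : ℝ} (hs : 0 ≤ s) (hsT : s < T) (hst : s ≤ t) (htT : t ≤ T)
    (y : Lp (EuclideanSpace ℝ d) 2 (volume : Measure (UnitAddTorus d))) :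
    ((propagator h𝔸 hlo hb hbdiv s t y : Lp (EuclideanSpace ℝ d) 2 volume) : UnitAddTorus d → EuclideanSpace ℝ d) =ᵐ[volume]
      windowRep h𝔸 hlo hb hbdiv hs hsT (Lp.memLp ((divFreeL2 d).starProjection y)) (isWeaklyDivFree_starProjection y) (t - s) := by
  rw [propagator_apply_of_mem h𝔸 hlo hb hbdiv hs hsT hst htT]
  exact MemLp.coeFn_toLp _

/-! ## The seven properties -/

omit [DecidableEq d] [Nonempty d] in
/-- `⟪toLp f, z⟫ = ∫⟪f, z⟫` for `f ∈ L²`. [folklore] -/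
private theorem inner_toLp_left {f : UnitAddTorus d → EuclideanSpace ℝ d} (hf : MemLp f 2 volume)
    (z : Lp (EuclideanSpace ℝ d) 2 (volume : Measure (UnitAddTorus d))) :
    ⟪hf.toLp f, z⟫_ℝ = ∫ x, ⟪f x, (z : UnitAddTorus d → EuclideanSpace ℝ d) x⟫_ℝ := by
  rw [MeasureTheory.L2.inner_def]
  exact integral_congr_ae (hf.coeFn_toLp.mono fun x hx => by simp only [hx])

section Properties

variable (h𝔸 : NearIso 𝔸 lo hi) (hlo : 0 < lo)
  (hb : MemLp (FunctionSpaces.Torus.stLift b) ∞ (volume.restrict (Ioo 0 T ×ˢ univ)))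
  (hbdiv : ∀ᵐ t ∂(volume.restrict (Ioo 0 T)), FunctionSpaces.Torus.IsWeaklyDivFree (b t))

include h𝔸 hlo hb hbdiv

/-- `norm_le`: the propagator is a contraction. [cite: Temam1984, Ch. III §1 Lemma 1.2] -/
theorem propagator_norm_le (s t : ℝ) (y : Lp (EuclideanSpace ℝ d) 2 (volume : Measure (UnitAddTorus d))) :
    ‖propagator h𝔸 hlo hb hbdiv s t y‖ ≤ ‖y‖ := by
  by_cases h : 0 ≤ s ∧ s < T ∧ s ≤ t ∧ t ≤ T
  · rw [propagator_apply_of_mem h𝔸 hlo hb hbdiv h.1 h.2.1 h.2.2.1 h.2.2.2]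
    exact norm_windowMapFun_le h𝔸 hlo hb hbdiv h.1 h.2.1 ⟨sub_nonneg.2 h.2.2.1, sub_le_sub_right h.2.2.2 s⟩ y
  · by_cases h2 : s = T ∧ t = T
    · obtain ⟨rfl, rfl⟩ := h2
      rw [propagator_apply_top]
      exact (divFreeL2 d).norm_starProjection_apply_le y
    · rw [propagator_apply_of_not h𝔸 hlo hb hbdiv h h2, norm_zero]
      exact norm_nonneg _

/-- `divFree`: the range is weakly divergence free. [cite: Pazy1983, Ch. 5 §5.1 Def. 5.3] [cite: Temam1984, Ch. III §1 Lemma 1.4] -/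
theorem propagator_divFree (s t : ℝ) (y : Lp (EuclideanSpace ℝ d) 2 (volume : Measure (UnitAddTorus d))) :
    FunctionSpaces.Torus.IsWeaklyDivFree
      ((propagator h𝔸 hlo hb hbdiv s t y : Lp (EuclideanSpace ℝ d) 2 volume) : UnitAddTorus d → EuclideanSpace ℝ d) := by
  by_cases h : 0 ≤ s ∧ s < T ∧ s ≤ t ∧ t ≤ T
  · have R := windowRep_spec h𝔸 hlo hb hbdiv h.1 h.2.1 (Lp.memLp ((divFreeL2 d).starProjection y)) (isWeaklyDivFree_starProjection y)
    exact (R.2.2.2.2.2.2.1 (t - s) ⟨sub_nonneg.2 h.2.2.1, sub_le_sub_right h.2.2.2 s⟩).congr_ae'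
      (coeFn_propagator_ae_eq h𝔸 hlo hb hbdiv h.1 h.2.1 h.2.2.1 h.2.2.2 y)
  · by_cases h2 : s = T ∧ t = T
    · obtain ⟨rfl, rfl⟩ := h2
      rw [propagator_apply_top]
      exact isWeaklyDivFree_starProjection y
    · rw [propagator_apply_of_not h𝔸 hlo hb hbdiv h h2]
      exact isWeaklyDivFree_zero'.congr_ae' (Lp.coeFn_zero _ _ _)

/-- `eq_zero_of_orth`: the propagator kills the orthogonal complement of the divergence-free classes (`U = S ∘ P_σ`).
[cite: Temam1984, Ch. I §1.4 Thm. 1.4] -/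
theorem propagator_eq_zero_of_orth (s t : ℝ) (y : Lp (EuclideanSpace ℝ d) 2 (volume : Measure (UnitAddTorus d)))
    (hy : ∀ z : Lp (EuclideanSpace ℝ d) 2 (volume : Measure (UnitAddTorus d)),
      FunctionSpaces.Torus.IsWeaklyDivFree (z : UnitAddTorus d → EuclideanSpace ℝ d) → ⟪y, z⟫_ℝ = 0) :
    propagator h𝔸 hlo hb hbdiv s t y = 0 := by
  have hP : (divFreeL2 d).starProjection y = 0 := by
    rw [Submodule.starProjection_apply_eq_zero_iff, Submodule.mem_orthogonal]
    intro u hu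
    rw [real_inner_comm]
    exact hy u ((mem_divFreeL2_iff u).1 hu)
  by_cases h : 0 ≤ s ∧ s < T ∧ s ≤ t ∧ t ≤ T
  · rw [propagator_apply_of_mem h𝔸 hlo hb hbdiv h.1 h.2.1 h.2.2.1 h.2.2.2,
      ← windowMapFun_starProjection h𝔸 hlo hb hbdiv h.1 h.2.1 ⟨sub_nonneg.2 h.2.2.1, sub_le_sub_right h.2.2.2 s⟩, hP,
      ← windowMap_apply h𝔸 hlo hb hbdiv h.1 h.2.1 ⟨sub_nonneg.2 h.2.2.1, sub_le_sub_right h.2.2.2 s⟩, map_zero]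
  · by_cases h2 : s = T ∧ t = T
    · obtain ⟨rfl, rfl⟩ := h2
      rw [propagator_apply_top, hP]
    · rw [propagator_apply_of_not h𝔸 hlo hb hbdiv h h2]

/-- `self_of_divFree`: at `t = s` the propagator is the identity on divergence-free data. [cite: Pazy1983, Ch. 5 §5.1 Def. 5.3] -/
theorem propagator_self_of_divFree (s : ℝ) (hs : 0 ≤ s) (hsT : s ≤ T) (y : Lp (EuclideanSpace ℝ d) 2 (volume : Measure (UnitAddTorus d)))
    (hy : FunctionSpaces.Torus.IsWeaklyDivFree (y : UnitAddTorus d → EuclideanSpace ℝ d)) :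
    propagator h𝔸 hlo hb hbdiv s s y = y := by
  have hP : (divFreeL2 d).starProjection y = y := Submodule.starProjection_eq_self_iff.2 ((mem_divFreeL2_iff y).2 hy)
  rcases hsT.eq_or_lt with rfl | hsT'
  · rw [propagator_apply_top, hP]
  · rw [propagator_apply_of_mem h𝔸 hlo hb hbdiv hs hsT' le_rfl hsT,
      windowMapFun_congr_lag h𝔸 hlo hb hbdiv hs hsT' (sub_nonneg.2 le_rfl) le_rfl (sub_self s)]
    have R := windowRep_spec h𝔸 hlo hb hbdiv hs hsT' (Lp.memLp ((divFreeL2 d).starProjection y)) (isWeaklyDivFree_starProjection y)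
    have h0 := R.2.2.2.2.1
    unfold windowMapFun
    calc (MemLp.toLp _ (memLp_windowRep h𝔸 hlo hb hbdiv hs hsT' (Lp.memLp ((divFreeL2 d).starProjection y))
            (isWeaklyDivFree_starProjection y) le_rfl) : Lp (EuclideanSpace ℝ d) 2 volume)
        = (Lp.memLp ((divFreeL2 d).starProjection y)).toLp
            (((divFreeL2 d).starProjection y : Lp (EuclideanSpace ℝ d) 2 volume) : UnitAddTorus d → EuclideanSpace ℝ d) :=
          MemLp.toLp_congr _ _ h0
      _ = (divFreeL2 d).starProjection y := Lp.toLp_coeFn _ _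
      _ = y := hP

/-- `continuousOn` (weak form): every pairing `t ↦ ⟪U s t y, z⟫` is continuous on `[s, T]`. [cite: Temam1984, Ch. III §1 Lemma 1.4] -/
theorem propagator_weaklyContinuousOn (s : ℝ) (hs : 0 ≤ s) (hsT : s ≤ T)
    (y z : Lp (EuclideanSpace ℝ d) 2 (volume : Measure (UnitAddTorus d))) :
    ContinuousOn (fun t => ⟪propagator h𝔸 hlo hb hbdiv s t y, z⟫_ℝ) (Icc s T) := by
  rcases hsT.eq_or_lt with rfl | hsT'
  · rw [Icc_self]
    exact continuousOn_singleton _ _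
  · set P := (divFreeL2 d).starProjection with hP
    have hy : MemLp ((P y : Lp (EuclideanSpace ℝ d) 2 volume) : UnitAddTorus d → EuclideanSpace ℝ d) 2 volume := Lp.memLp _
    have R := windowRep_spec h𝔸 hlo hb hbdiv hs hsT' hy (isWeaklyDivFree_starProjection y)
    -- the pairing of the representative with `z`, composed with `t ↦ t − s`
    have hc : ContinuousOn (fun t => ∫ x, ⟪windowRep h𝔸 hlo hb hbdiv hs hsT' hy (isWeaklyDivFree_starProjection y) (t - s) x,
        (z : UnitAddTorus d → EuclideanSpace ℝ d) x⟫_ℝ) (Icc s T) := by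
      have h1 := R.2.2.2.2.2.1 (z : UnitAddTorus d → EuclideanSpace ℝ d) (Lp.memLp z)
      refine (h1.comp (continuousOn_id.sub continuousOn_const) fun t ht => ?_)
      exact ⟨sub_nonneg.2 ht.1, sub_le_sub_right ht.2 s⟩
    refine hc.congr fun t ht => ?_
    show ⟪propagator h𝔸 hlo hb hbdiv s t y, z⟫_ℝ = _
    rw [propagator_apply_of_mem h𝔸 hlo hb hbdiv hs hsT' ht.1 ht.2]
    unfold windowMapFun
    exact inner_toLp_left _ z

/-- `repr`: every weak solution from every divergence-free `L²` datum is represented by the propagator, for a.e. time.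
[cite: DiPernaLions1989, §II.1 (12)–(14)] -/
theorem propagator_repr (s : ℝ) (hs : 0 ≤ s) (hsT : s < T) (φ : UnitAddTorus d → EuclideanSpace ℝ d) (hφ : MemLp φ 2 volume)
    (hφdiv : FunctionSpaces.Torus.IsWeaklyDivFree φ) (w : ℝ → UnitAddTorus d → EuclideanSpace ℝ d)
    (hw : IsWeakTensorPassiveVectorOn 0 (T - s) 𝔸 (fun τ => b (s + τ)) φ w) :
    ∀ᵐ τ ∂(volume.restrict (Ioo 0 (T - s))), ∃ hτ : MemLp (w τ) 2 volume,
      hτ.toLp (w τ) = propagator h𝔸 hlo hb hbdiv s (s + τ) (hφ.toLp φ) := by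
  set P := (divFreeL2 d).starProjection with hP
  set yφ : Lp (EuclideanSpace ℝ d) 2 (volume : Measure (UnitAddTorus d)) := hφ.toLp φ with hyφ
  have hyφdiv : FunctionSpaces.Torus.IsWeaklyDivFree (yφ : UnitAddTorus d → EuclideanSpace ℝ d) :=
    hφdiv.congr_ae' hφ.coeFn_toLp
  have hPy : P yφ = yφ := Submodule.starProjection_eq_self_iff.2 ((mem_divFreeL2_iff yφ).2 hyφdiv)
  have hy : MemLp ((P yφ : Lp (EuclideanSpace ℝ d) 2 volume) : UnitAddTorus d → EuclideanSpace ℝ d) 2 volume := Lp.memLp _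
  have hae : ((P yφ : Lp (EuclideanSpace ℝ d) 2 volume) : UnitAddTorus d → EuclideanSpace ℝ d) =ᵐ[volume] φ := by
    rw [hPy]
    exact hφ.coeFn_toLp
  -- the chosen solution and its representative, from the datum `P yφ`
  have hsol := windowSol_spec h𝔸 hlo hb hbdiv hs hsT hy (isWeaklyDivFree_starProjection yφ)
  have R := windowRep_spec h𝔸 hlo hb hbdiv hs hsT hy (isWeaklyDivFree_starProjection yφ)
  -- uniqueness: `w` and the chosen solution agree a.e.
  have huniq := IsWeakTensorPassiveVectorOn.ae_eq_of_memLp_top h𝔸 hlo hw (hsol.congr_datum hae.symm)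
    (memLp_top_stLift_comp_add_left hb hs)
  filter_upwards [huniq, R.2.2.2.1, hw.ae_memLp_two, ae_restrict_mem measurableSet_Ioo] with τ h1 h2 hm hτ
  refine ⟨hm, ?_⟩
  rw [propagator_apply_of_mem h𝔸 hlo hb hbdiv hs hsT (by linarith [hτ.1]) (by linarith [hτ.2]),
    windowMapFun_congr_lag h𝔸 hlo hb hbdiv hs hsT (sub_nonneg.2 (by linarith [hτ.1])) hτ.1.le (add_sub_cancel_left s τ)]
  unfold windowMapFun
  exact MemLp.toLp_congr _ _ (h1.trans h2.symm)

/-- `comp`: the cocycle property `U t r ∘ U s t = U s r` for `0 ≤ s ≤ t ≤ r ≤ T` (restart of the chosen solution at `t` from the value of its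
representative + uniqueness of weak solutions and of representatives). [cite: Pazy1983, Ch. 5 §5.1 Def. 5.3] [cite: DiPernaLions1989, §II.1 (12)–(14)] -/
theorem propagator_comp (s t r : ℝ) (hs : 0 ≤ s) (hst : s ≤ t) (htr : t ≤ r) (hrT : r ≤ T)
    (y : Lp (EuclideanSpace ℝ d) 2 (volume : Measure (UnitAddTorus d))) :
    propagator h𝔸 hlo hb hbdiv t r (propagator h𝔸 hlo hb hbdiv s t y) = propagator h𝔸 hlo hb hbdiv s r y := by
  set P := (divFreeL2 d).starProjection with hP
  rcases (htr.trans hrT).eq_or_lt with htT | htT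
  · -- `t = T`, hence `r = T`: `U T T` is the σ-projection, which fixes the (divergence-free) value `U s T y`
    have hrT' : r = T := le_antisymm hrT (htT ▸ htr)
    rw [hrT', htT, propagator_apply_top]
    exact Submodule.starProjection_eq_self_iff.2 ((mem_divFreeL2_iff _).2 (propagator_divFree h𝔸 hlo hb hbdiv s T y))
  · have hsT : s < T := hst.trans_lt htT
    -- the three window maps
    have hy : MemLp ((P y : Lp (EuclideanSpace ℝ d) 2 volume) : UnitAddTorus d → EuclideanSpace ℝ d) 2 volume := Lp.memLp _
    have R₁ := windowRep_spec h𝔸 hlo hb hbdiv hs hsT hy (isWeaklyDivFree_starProjection y)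
    have hsol₁ := windowSol_spec h𝔸 hlo hb hbdiv hs hsT hy (isWeaklyDivFree_starProjection y)
    set W₁ := windowRep h𝔸 hlo hb hbdiv hs hsT hy (isWeaklyDivFree_starProjection y) with hW₁
    set w₁ := windowSol h𝔸 hlo hb hbdiv hs hsT hy (isWeaklyDivFree_starProjection y) with hw₁
    -- the intermediate value `y₁ = U s t y` and its datum
    set y₁ : Lp (EuclideanSpace ℝ d) 2 (volume : Measure (UnitAddTorus d)) := propagator h𝔸 hlo hb hbdiv s t y with hy₁
    have hy₁ae : (y₁ : UnitAddTorus d → EuclideanSpace ℝ d) =ᵐ[volume] W₁ (t - s) :=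
      coeFn_propagator_ae_eq h𝔸 hlo hb hbdiv hs hsT hst htT.le y
    have hy₁div : FunctionSpaces.Torus.IsWeaklyDivFree (y₁ : UnitAddTorus d → EuclideanSpace ℝ d) :=
      propagator_divFree h𝔸 hlo hb hbdiv s t y
    have hPy₁ : P y₁ = y₁ := Submodule.starProjection_eq_self_iff.2 ((mem_divFreeL2_iff y₁).2 hy₁div)
    have hy₁' : MemLp ((P y₁ : Lp (EuclideanSpace ℝ d) 2 volume) : UnitAddTorus d → EuclideanSpace ℝ d) 2 volume := Lp.memLp _
    have hdat : ((P y₁ : Lp (EuclideanSpace ℝ d) 2 volume) : UnitAddTorus d → EuclideanSpace ℝ d) =ᵐ[volume] W₁ (t - s) := by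
      rw [hPy₁]; exact hy₁ae
    have R₂ := windowRep_spec h𝔸 hlo hb hbdiv (hs.trans hst) htT hy₁' (isWeaklyDivFree_starProjection y₁)
    have hsol₂ := windowSol_spec h𝔸 hlo hb hbdiv (hs.trans hst) htT hy₁' (isWeaklyDivFree_starProjection y₁)
    -- the translate of the first solution solves, at base `t`, from `W₁ (t − s)`
    have htrans₀ := IsWeakTensorPassiveVectorOn.translate_time_of_traces hsol₁ (sub_nonneg.2 hst)
      (by linarith : t - s < T - s) (W := W₁) R₁.2.2.2.2.2.2.2
    have e1 : T - s - (t - s) = T - t := by ring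
    have e2 : (fun τ => b (s + (t - s + τ))) = fun τ => b (t + τ) := by
      funext τ; congr 1; ring
    have htrans : IsWeakTensorPassiveVectorOn 0 (T - t) 𝔸 (fun τ => b (t + τ)) (W₁ (t - s)) (fun τ => w₁ (t - s + τ)) := by
      have h := htrans₀
      rw [e1, e2] at h
      exact h
    -- uniqueness of representatives at base `t`: `W₂ τ = W₁ (t − s + τ)` for every `τ ∈ [0, T − t]`
    have hTt : 0 < T - t := sub_pos.2 htT
    have key := IsWeakTensorPassiveVectorOn.representative_ae_eq hTt h𝔸 hlo (hsol₂.congr_datum hdat.symm) htrans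
      (memLp_top_stLift_comp_add_left hb (hs.trans hst))
      (W₁ := windowRep h𝔸 hlo hb hbdiv (hs.trans hst) htT hy₁' (isWeaklyDivFree_starProjection y₁))
      (W₂ := fun τ => W₁ (t - s + τ))
      (fun τ hτ => R₂.1 τ hτ.1) (fun τ hτ => R₁.1 _ (by linarith [hτ.1, sub_nonneg.2 hst]))
      R₂.2.2.2.2.2.1
      (fun ψ hψ => by
        have h1 := R₁.2.2.2.2.2.1 ψ hψ
        refine h1.comp (continuousOn_const.add continuousOn_id) fun τ hτ => ?_
        exact ⟨by linarith [hτ.1, sub_nonneg.2 hst], by linarith [hτ.2]⟩)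
      R₂.2.2.2.1
      (ae_restrict_Ioo_comp_add_left (P := fun σ => W₁ σ =ᵐ[volume] w₁ σ) R₁.2.2.2.1 (sub_nonneg.2 hst) (by linarith))
      (r - t) ⟨sub_nonneg.2 htr, sub_le_sub_right hrT t⟩
    have e3 : t - s + (r - t) = r - s := by ring
    rw [e3] at key
    -- assemble
    rw [propagator_apply_of_mem h𝔸 hlo hb hbdiv (hs.trans hst) htT htr hrT,
      propagator_apply_of_mem h𝔸 hlo hb hbdiv hs hsT (hst.trans htr) hrT]
    unfold windowMapFun
    exact MemLp.toLp_congr _ _ key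

/-- **EXISTENCE OF THE PROPAGATOR** (S0′): for `0 < T`, an elliptic constant tensor and a bounded, a.e. weakly divergence-free carrier, the
two-parameter solution propagator of the linear passive-vector problem exists with all seven properties of `IsPropagator`.
[cite: Pazy1983, Ch. 5 §5.1 Def. 5.3] [cite: LionsMagenes1972, Chap. 3 Thm. 1.1] -/
theorem exists_isPropagator : ∃ U, IsPropagator (d := d) T b 𝔸 U :=
  ⟨propagator h𝔸 hlo hb hbdiv,
    { norm_le := propagator_norm_le h𝔸 hlo hb hbdiv
      comp := propagator_comp h𝔸 hlo hb hbdiv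
      self_of_divFree := propagator_self_of_divFree h𝔸 hlo hb hbdiv
      divFree := propagator_divFree h𝔸 hlo hb hbdiv
      eq_zero_of_orth := propagator_eq_zero_of_orth h𝔸 hlo hb hbdiv
      continuousOn := propagator_weaklyContinuousOn h𝔸 hlo hb hbdiv
      repr := propagator_repr h𝔸 hlo hb hbdiv }⟩

end Properties

end Construction

end Torus

end Literature.Analysis.FluidPDE

end
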